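import Literature.Analysis.FluidPDE.TaoForcedUniquenessSchwartzForce
import HarnessLib

/-!
# Fefferman's force class under time shifts and on slabs

Analysis/FluidPDE proof file (theorems only; no definitions, no named facts). Plumbing about the
Clay class of forces (C. L. Fefferman, Clay problem description, (5): `f ∈ C^∞([0,∞) × ℝⁿ)` with
`|∂ₓ^α ∂ₜ^m f(x, t)| ≤ C_{αmK} (1 + |x| + t)^{-K}`; tree: `IsSmoothOnHalfSpace f`,
`HasRapidSpaceTimeDecay f`) needed when a forced Navier–Stokes flow is RESTARTED at a time `t₀ ≥ 0`
(the restarted flow is driven by the shifted force `s ↦ f (s + t₀)`) and when Tao's slab-local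
Schwartz hypothesis (T. Tao, Anal. PDE 6 (2013), p. 3: `sup_{[0,T] × ℝ³} (1 + |x|)^k |∇ₓ^α ∂ₜ^m f|
< ∞`; tree: `HasUniformRapidDecayOn (Icc 0 T) f`) is to be read off Fefferman's class:

* `IsSmoothOnHalfSpace.timeShift`, `HasRapidSpaceTimeDecay.timeShift` — Fefferman's class is
  invariant under forward time shifts `t₀ ≥ 0` (the space–time derivatives of the shifted force
  within the half-space are those of `f` within the shifted half-space `[t₀, ∞) × E`, which agree
  with the derivatives within `[0, ∞) × E` by unique differentiability —
  Mathlib `iteratedFDerivWithin_comp_add_right`, `iteratedFDerivWithin_subset` — and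
  `(1 + |x| + t)^{-K} ≥ (1 + |x| + t + t₀)^{-K}`);
* `HasRapidSpaceTimeDecay.hasUniformRapidDecayOn_Icc` — Fefferman's (5) gives Tao's Schwartz
  bounds on every slab `[0, T]`, `T > 0` (derivatives within the slab = derivatives within the
  half-space; drop the time weight);
* the shifted-slab corollaries `IsSmoothOnHalfSpace.isSmoothSpaceTimeOn_Icc_timeShift`,
  `HasRapidSpaceTimeDecay.hasUniformRapidDecayOn_Icc_timeShift`.

Consumer: the cell `ns-blowup` (E–C route `PalasekTowerBreakdown`: restart of the level-`k` flow
under the design force, `ForcedClassicalContinuation`).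

## Tree search

`lean search 'timeShift|comp_add_right|HasUniformRapidDecayOn'`: `isSmoothOnHalfSpace_timeShift`
exists only inside `FluidComputerGadgetOneShot` (namespace `…FluidComputer`, `ℝ³`-valued, heavy
import — restated here for a general space in the root fluid namespace);
`IsSmoothSpaceTimeOn.comp_add_right` (`ClassicalSolutionGlue`) shifts on a general time set;
`hasRapidSpaceTimeDecay_timeRescale` (`PalasekTowerViscosity`, Summits side) treats DILATIONS, not
shifts; `HasRapidSpaceTimeDecay.hasUniformRapidDecayOn` (`TaoForcedUniquenessSchwartzForce`) drops
the time weight on the half-space but does not restrict to a slab. Nothing else.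

## References

* C. L. Fefferman, *Existence and smoothness of the Navier–Stokes equation*, Clay Mathematics
  Institute (2006), (5). [FeffermanClay2006]
* T. Tao, *Localisation and compactness properties of the Navier–Stokes global regularity
  problem*, Anal. PDE 6 (2013), §1, p. 3 (Schwartz data). [Tao2011]
-/

noncomputable section

open MeasureTheory Set Function Filter Topology
open scoped ENNReal NNReal ContDiff Pointwise

namespace Literature.Analysis.FluidPDE

section Shift

variable {E : Type*} [NormedAddCommGroup E] [InnerProductSpace ℝ E]
  {F : Type*} [NormedAddCommGroup F] [NormedSpace ℝ F]

omit [InnerProductSpace ℝ E] in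
/-- Translating the closed half-space `[a, ∞) × E` by `(t₀, 0)` gives `[a + t₀, ∞) × E`. [folklore] -/
private theorem vadd_Ici_prod_univ (a t₀ : ℝ) :
    ((t₀, (0 : E)) : ℝ × E) +ᵥ (Ici a ×ˢ (univ : Set E)) = Ici (a + t₀) ×ˢ (univ : Set E) := by
  ext z
  simp only [Set.mem_vadd_set, mem_prod, mem_Ici, mem_univ, and_true]
  constructor
  · rintro ⟨y, hy, rfl⟩
    simp only [vadd_eq_add, Prod.fst_add]
    linarith
  · intro hz
    refine ⟨(z.1 - t₀, z.2), ?_, by ext <;> simp⟩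
    simp only
    linarith

omit [InnerProductSpace ℝ E] [NormedAddCommGroup F] [NormedSpace ℝ F] in
/-- Uncurrying a time shift: `uncurry (s ↦ f (s + t₀)) = uncurry f ∘ (· + (t₀, 0))`. [folklore] -/
private theorem uncurry_timeShift (f : ℝ → E → F) (t₀ : ℝ) :
    uncurry (fun s => f (s + t₀)) = fun z : ℝ × E => uncurry f (z + (t₀, 0)) := by
  funext z
  obtain ⟨s, x⟩ := z
  simp

/-- **Fefferman's smoothness (6)/(11) on the closed half-space is invariant under forward time
shifts**: if `w` is `C^∞` on `[0, ∞) × E` then so is `s ↦ w (s + t₀)` for `t₀ ≥ 0` (the shift maps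
the half-space into itself). [cite: FeffermanClay2006, (5)-(6)] -/
theorem IsSmoothOnHalfSpace.timeShift {w : ℝ → E → F} (hw : IsSmoothOnHalfSpace w) {t₀ : ℝ}
    (ht₀ : 0 ≤ t₀) : IsSmoothOnHalfSpace (fun s => w (s + t₀)) := by
  have hg : ContDiff ℝ ∞ (fun q : ℝ × E => (q.1 + t₀, q.2)) := by fun_prop
  have hmaps : MapsTo (fun q : ℝ × E => (q.1 + t₀, q.2))
      (Ici (0 : ℝ) ×ˢ (univ : Set E)) (Ici (0 : ℝ) ×ˢ (univ : Set E)) := by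
    intro q hq
    simp only [mem_prod, mem_Ici, mem_univ, and_true] at hq ⊢
    linarith
  exact ContDiffOn.comp hw hg.contDiffOn hmaps

/-- The space–time derivatives of the shifted force within the half-space are those of `f` within
the half-space at the shifted point (`t₀ ≥ 0`; Mathlib `iteratedFDerivWithin_comp_add_right` and
`iteratedFDerivWithin_subset` on `[t₀, ∞) × E ⊆ [0, ∞) × E`). [folklore] -/
private theorem IsSmoothOnHalfSpace.iteratedFDerivWithin_timeShift {f : ℝ → E → F}
    (hs : IsSmoothOnHalfSpace f) {t₀ : ℝ} (ht₀ : 0 ≤ t₀) (n : ℕ) {t : ℝ} (ht : 0 ≤ t) (x : E) :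
    iteratedFDerivWithin ℝ n (uncurry fun s => f (s + t₀)) (Ici (0 : ℝ) ×ˢ univ) (t, x) =
      iteratedFDerivWithin ℝ n (uncurry f) (Ici (0 : ℝ) ×ˢ univ) (t + t₀, x) := by
  rw [uncurry_timeShift, iteratedFDerivWithin_comp_add_right, vadd_Ici_prod_univ, zero_add]
  have hpt : ((t, x) : ℝ × E) + (t₀, 0) = (t + t₀, x) := by ext <;> simp
  rw [hpt]
  have hsub : Ici t₀ ×ˢ (univ : Set E) ⊆ Ici (0 : ℝ) ×ˢ (univ : Set E) :=
    prod_mono (Ici_subset_Ici.2 ht₀) subset_rfl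
  have hn : ContDiffOn ℝ n (uncurry f) (Ici (0 : ℝ) ×ˢ (univ : Set E)) :=
    hs.of_le (by exact_mod_cast le_top)
  exact iteratedFDerivWithin_subset hsub ((uniqueDiffOn_Ici t₀).prod uniqueDiffOn_univ)
    ((uniqueDiffOn_Ici 0).prod uniqueDiffOn_univ) hn (mk_mem_prod (by simpa using ht) (mem_univ x))

/-- **Fefferman's space–time decay (5) is invariant under forward time shifts**: for `f` smooth on
the closed half-space with `(1 + |x| + t)^K ‖Dⁿ f(t, x)‖ ≤ C_{n,K}` and `t₀ ≥ 0`, the shifted force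
`s ↦ f (s + t₀)` obeys the same bounds with the same constants (its derivatives within the
half-space are those of `f` at the shifted point, and the weight only decreases:
`1 + |x| + t ≤ 1 + |x| + (t + t₀)`). [cite: FeffermanClay2006, (5)] -/
theorem HasRapidSpaceTimeDecay.timeShift {f : ℝ → E → F} (hs : IsSmoothOnHalfSpace f)
    (hd : HasRapidSpaceTimeDecay f) {t₀ : ℝ} (ht₀ : 0 ≤ t₀) :
    HasRapidSpaceTimeDecay (fun s => f (s + t₀)) := by
  intro n K
  obtain ⟨C, hC⟩ := hd n K
  refine ⟨C, fun t ht x => ?_⟩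
  rw [hs.iteratedFDerivWithin_timeShift ht₀ n ht x]
  have h1 : (1 + ‖x‖ + t) ^ K ≤ (1 + ‖x‖ + (t + t₀)) ^ K :=
    pow_le_pow_left₀ (by positivity) (by linarith) K
  exact (mul_le_mul_of_nonneg_right h1 (norm_nonneg _)).trans (hC (t + t₀) (by linarith) x)

/-- On a slab `[0, T]`, `T > 0`, the space–time derivatives within the slab of a force smooth on
the closed half-space are its derivatives within the half-space (unique differentiability of both
sets; Mathlib `iteratedFDerivWithin_subset`). [folklore] -/
private theorem IsSmoothOnHalfSpace.iteratedFDerivWithin_Icc_eq {f : ℝ → E → F}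
    (hs : IsSmoothOnHalfSpace f) {T : ℝ} (hT : 0 < T) (n : ℕ) {t : ℝ} (ht : t ∈ Icc 0 T) (x : E) :
    iteratedFDerivWithin ℝ n (uncurry f) (Icc 0 T ×ˢ univ) (t, x) =
      iteratedFDerivWithin ℝ n (uncurry f) (Ici (0 : ℝ) ×ˢ univ) (t, x) := by
  have hsub : Icc 0 T ×ˢ (univ : Set E) ⊆ Ici (0 : ℝ) ×ˢ (univ : Set E) :=
    prod_mono Icc_subset_Ici_self subset_rfl
  have hn : ContDiffOn ℝ n (uncurry f) (Ici (0 : ℝ) ×ˢ (univ : Set E)) :=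
    hs.of_le (by exact_mod_cast le_top)
  exact iteratedFDerivWithin_subset hsub ((uniqueDiffOn_Icc hT).prod uniqueDiffOn_univ)
    ((uniqueDiffOn_Ici 0).prod uniqueDiffOn_univ) hn (mk_mem_prod ht (mem_univ x))

/-- **Fefferman's class gives Tao's Schwartz bounds on every slab**: a force smooth on the closed
half-space with the space–time decay (5) has `(1 + ‖x‖)^K ‖Dⁿf(t, x)‖ ≤ C_{n,K}` for the derivatives
WITHIN the slab `[0, T] × E`, `T > 0` — Tao's "`(u₀, f, T)` Schwartz" for the force
(Tao 2013, p. 3). [cite: Tao2011, §1 p. 3] [cite: FeffermanClay2006, (5)] -/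
theorem HasRapidSpaceTimeDecay.hasUniformRapidDecayOn_Icc {f : ℝ → E → F}
    (hs : IsSmoothOnHalfSpace f) (hd : HasRapidSpaceTimeDecay f) {T : ℝ} (hT : 0 < T) :
    HasUniformRapidDecayOn (Icc 0 T) f := by
  intro n K
  obtain ⟨C, hC⟩ := hd.hasUniformRapidDecayOn n K
  refine ⟨C, fun t ht x => ?_⟩
  rw [hs.iteratedFDerivWithin_Icc_eq hT n ht x]
  exact hC t (mem_Ici.2 ht.1) x

/-- The shifted force is jointly smooth on every slab `[0, T]` (`t₀ ≥ 0`). [cite: FeffermanClay2006, (5)-(6)] -/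
theorem IsSmoothOnHalfSpace.isSmoothSpaceTimeOn_Icc_timeShift {w : ℝ → E → F}
    (hw : IsSmoothOnHalfSpace w) {t₀ : ℝ} (ht₀ : 0 ≤ t₀) (T : ℝ) :
    IsSmoothSpaceTimeOn (Icc 0 T) (fun s => w (s + t₀)) :=
  (hw.timeShift ht₀).isSmoothSpaceTimeOn_Icc T

/-- **The shifted force has Tao's Schwartz bounds on every slab** `[0, T]`, `T > 0`, `t₀ ≥ 0`: the
slab-local force hypothesis of Tao 2013, Thm. 5.4, for the restart at time `t₀` of a flow driven by a
Clay-class force. [cite: Tao2011, §1 p. 3] [cite: FeffermanClay2006, (5)] -/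
theorem HasRapidSpaceTimeDecay.hasUniformRapidDecayOn_Icc_timeShift {f : ℝ → E → F}
    (hs : IsSmoothOnHalfSpace f) (hd : HasRapidSpaceTimeDecay f) {t₀ : ℝ} (ht₀ : 0 ≤ t₀) {T : ℝ}
    (hT : 0 < T) : HasUniformRapidDecayOn (Icc 0 T) (fun s => f (s + t₀)) :=
  (hd.timeShift hs ht₀).hasUniformRapidDecayOn_Icc (hs.timeShift ht₀) hT

end Shift

end Literature.Analysis.FluidPDE

end
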